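import Mathlib
import HarnessLib
import Literature.NumberTheory.Sieve.LiouvillePolynomialValuesSmoothProofs
import Summits.Parity.BatemanHorn.Theses.IsogenyRedei

/-!
# Route IsogenyRedei — the unconditional kernel of the WALL LEMMA (item stmt-Parity-11618)

The support item `WallLemma` (rank 9) of route `IsogenyRedei` is filed INFORMAL: the route file
`Summits/Parity/BatemanHorn/Theses/IsogenyRedei.lean` carries no Lean statement for it (it is the
card-P3 bookkeeping "a configuration of the linked-index expansion of `Σ_{t ≤ x} 2^{k s_φ(t)}` is
Type-I + character-sum expressible iff `F(t) = t² + 1` has a dominant prime factor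
`P⁺(F(t)) ≥ F(t)·x^{ε-1}`; the complementary split-block configurations have trivial mass `≍ x`,
not `o(x)`, and live on the dominant-free values, of (conjectural Dickman) density `1 − log 2`").

Of its three clauses, the "iff expressible" clause quantifies over methods (not a `Prop`), and the
density `1 − log 2` is NOT a theorem (G. Martin 2002 proves the Dickman law for friable polynomial
values only under his uniform Hypothesis UH; by the Chebyshev–Hooley route it is the largest-prime-
factor problem for `n² + 1` beyond `x^{1.279}`).  What IS a theorem, and is proved here, is the
quantitative kernel every refuter/grounder note on the item isolates — the `k = 0` reading of
"split-block mass `≍ x`, not `o(x)`":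

* `isogenyRedei_wallLemma_dominantFree_pos_density` — for every `ε > 0` the DOMINANT-FREE values
  (`P⁺(t²+1)·x^{1-ε} < t²+1`, i.e. no prime factor `≥ (t²+1)·x^{ε-1}`: exactly the item's
  split-block class) have positive lower density among `1 ≤ t ≤ x`;
* `isogenyRedei_wallLemma_friable_pos_density` / `…_friable_rpow_pos_density` — the complement of
  the Chebyshev–Hooley class: `#{1 ≤ t ≤ x : P⁺(t²+1) ≤ x} ≫ x`, hence `P⁺(t²+1) ≤ x^{1+ε}` for
  `≫ x` values, for every `ε ≥ 0`.

All three are corollaries of the tree theorem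
`Literature.NumberTheory.Sieve.sq_add_one_smooth_pos_density` (`n² + 1` is `n`-smooth for `≥ c·X`
integers `n ≤ X`, PROVED there from Iwaniec's level of distribution `x^{16/15}` for `n² + 1`): an
`n`-smooth value with `n > (c/2)·x` is dominant-free as soon as `x^ε ≥ 4/c²`, and at most `(c/2)·x`
of the smooth `n ≤ x` are `≤ (c/2)·x`.
-/

namespace Summit.Parity.BatemanHorn.Theorems

open Finset Real Filter
open scoped Classical

/-- **Friable values of `t² + 1` have positive lower density** (complement of the
Chebyshev–Hooley class): there are `c > 0` and `x₀` with
`c·x ≤ #{1 ≤ t ≤ x : every prime factor of t² + 1 is ≤ x}` for all `x ≥ x₀`.  Immediate from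
`Literature.NumberTheory.Sieve.sq_add_one_smooth_pos_density` (`p ≤ t ≤ x`). -/
theorem isogenyRedei_wallLemma_friable_pos_density :
    ∃ c : ℝ, 0 < c ∧ ∃ x₀ : ℕ, ∀ x : ℕ, x₀ ≤ x →
      c * (x : ℝ) ≤ (((Finset.Icc 1 x).filter fun t : ℕ =>
        ∀ p : ℕ, p ∈ (t ^ 2 + 1).primeFactors → p ≤ x).card : ℝ) := by
  obtain ⟨c, hc, X₀, hX₀⟩ := Literature.NumberTheory.Sieve.sq_add_one_smooth_pos_density
  refine ⟨c, hc, X₀, fun x hx => (hX₀ x hx).trans ?_⟩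
  exact_mod_cast Finset.card_le_card fun t ht => by
    rw [Finset.mem_filter, Finset.mem_Icc] at ht ⊢
    refine ⟨ht.1, fun p hp => ?_⟩
    rw [Nat.mem_primeFactors] at hp
    exact (ht.2 p hp.1 hp.2.1).trans ht.1.2

/-- **Friable values at level `x^{1+ε}`** (the form in which the item's notes state the
unconditional half of the wall lemma): for every `ε ≥ 0` there are `c > 0` and `x₀` with
`c·x ≤ #{1 ≤ t ≤ x : every prime factor p of t² + 1 has p ≤ x^{1+ε}}` for all `x ≥ x₀`. -/
theorem isogenyRedei_wallLemma_friable_rpow_pos_density (ε : ℝ) (hε : 0 ≤ ε) :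
    ∃ c : ℝ, 0 < c ∧ ∃ x₀ : ℕ, ∀ x : ℕ, x₀ ≤ x →
      c * (x : ℝ) ≤ (((Finset.Icc 1 x).filter fun t : ℕ =>
        ∀ p : ℕ, p ∈ (t ^ 2 + 1).primeFactors → (p : ℝ) ≤ (x : ℝ) ^ (1 + ε)).card : ℝ) := by
  obtain ⟨c, hc, x₀, hx₀⟩ := isogenyRedei_wallLemma_friable_pos_density
  refine ⟨c, hc, max x₀ 1, fun x hx => (hx₀ x ((le_max_left _ _).trans hx)).trans ?_⟩
  have hx1 : (1 : ℝ) ≤ (x : ℝ) := by exact_mod_cast (le_max_right _ _).trans hx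
  exact_mod_cast Finset.card_le_card fun t ht => by
    rw [Finset.mem_filter] at ht ⊢
    refine ⟨ht.1, fun p hp => ?_⟩
    have h1 : (p : ℝ) ≤ (x : ℝ) := by exact_mod_cast ht.2 p hp
    exact h1.trans (Real.self_le_rpow_of_one_le hx1 (by linarith))

/-- **Dominant-free values of `t² + 1` have positive lower density** (route IsogenyRedei, the
unconditional `k = 0` kernel of the informal support `WallLemma`, stmt-Parity-11618: "the
split-block configurations have trivial mass `≍ x`, not `o(x)`"): for every `ε > 0` there are
`c > 0` and `x₀` such that for all `x ≥ x₀` at least `c·x` integers `1 ≤ t ≤ x` have NO dominant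
prime factor, i.e. every prime `p ∣ t² + 1` satisfies `p·x^{1-ε} < t² + 1` (the cofactor
`(t²+1)/p` exceeds `x^{1-ε}`, so the remaining primes cannot all be enumerated with product
`≤ x^{1-ε}`).  Proof: an `n`-smooth value `n² + 1` (tree:
`Literature.NumberTheory.Sieve.sq_add_one_smooth_pos_density`, density `c`) with `n > (c/2)·x` has
`p·x^{1-ε} ≤ x^{2-ε} ≤ (c/2)²x² < n² + 1` once `x^ε ≥ 4/c²`; discarding the `n ≤ (c/2)·x` costs at
most `(c/2)·x`.  (The asserted density `1 − log 2` is conjectural — Martin 2002 under Hypothesis UH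
— and is deliberately not claimed.) -/
theorem isogenyRedei_wallLemma_dominantFree_pos_density (ε : ℝ) (hε : 0 < ε) :
    ∃ c : ℝ, 0 < c ∧ ∃ x₀ : ℕ, ∀ x : ℕ, x₀ ≤ x →
      c * (x : ℝ) ≤ (((Finset.Icc 1 x).filter fun t : ℕ =>
        ∀ p : ℕ, p ∈ (t ^ 2 + 1).primeFactors →
          (p : ℝ) * (x : ℝ) ^ (1 - ε) < (t : ℝ) ^ 2 + 1).card : ℝ) := by
  obtain ⟨c, hc, X₀, hX₀⟩ := Literature.NumberTheory.Sieve.sq_add_one_smooth_pos_density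
  -- largeness: `4 / c² ≤ x^ε`
  have hev : ∀ᶠ x : ℕ in atTop, 4 / c ^ 2 ≤ (x : ℝ) ^ ε :=
    ((tendsto_rpow_atTop hε).comp tendsto_natCast_atTop_atTop).eventually_ge_atTop _
  obtain ⟨x₁, hx₁⟩ := Filter.eventually_atTop.mp hev
  refine ⟨c / 2, by positivity, max X₀ (max x₁ 1), fun x hx => ?_⟩
  have hxX₀ : X₀ ≤ x := (le_max_left _ _).trans hx
  have hxx₁ : x₁ ≤ x := ((le_max_left _ _).trans (le_max_right _ _)).trans hx
  have hx1 : (1 : ℝ) ≤ (x : ℝ) := by exact_mod_cast ((le_max_right _ _).trans (le_max_right _ _)).trans hx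
  have hxpos : (0 : ℝ) < (x : ℝ) := by linarith
  have hlarge : 4 / c ^ 2 ≤ (x : ℝ) ^ ε := hx₁ x hxx₁
  -- the smooth set, the small set, the target set
  set S : Finset ℕ := (Finset.Icc 1 x).filter fun n : ℕ =>
    ∀ p : ℕ, p.Prime → p ∣ n ^ 2 + 1 → p ≤ n with hS
  set A : Finset ℕ := Finset.Icc 1 ⌊c / 2 * (x : ℝ)⌋₊ with hA
  set T : Finset ℕ := (Finset.Icc 1 x).filter fun t : ℕ =>
    ∀ p : ℕ, p ∈ (t ^ 2 + 1).primeFactors → (p : ℝ) * (x : ℝ) ^ (1 - ε) < (t : ℝ) ^ 2 + 1 with hT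
  have hSc : c * (x : ℝ) ≤ (S.card : ℝ) := hX₀ x hxX₀
  have hAc : (A.card : ℝ) ≤ c / 2 * (x : ℝ) := by
    rw [hA, Nat.card_Icc, Nat.add_sub_cancel]
    exact Nat.floor_le (by positivity)
  -- key inclusion: a smooth `t` that is not small is dominant-free
  have hsub : S ⊆ A ∪ T := by
    intro t ht
    rw [hS, Finset.mem_filter, Finset.mem_Icc] at ht
    rw [Finset.mem_union]
    by_cases hsmall : (t : ℝ) ≤ c / 2 * (x : ℝ)
    · left
      rw [hA, Finset.mem_Icc]
      exact ⟨ht.1.1, Nat.le_floor hsmall⟩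
    · right
      push Not at hsmall
      rw [hT, Finset.mem_filter, Finset.mem_Icc]
      refine ⟨ht.1, fun p hp => ?_⟩
      rw [Nat.mem_primeFactors] at hp
      have hpt : p ≤ t := ht.2 p hp.1 hp.2.1
      have hpx : (p : ℝ) ≤ (x : ℝ) := by exact_mod_cast hpt.trans ht.1.2
      -- p * x^(1-ε) ≤ x * x^(1-ε) = x^2 / x^ε ≤ x^2 * c^2/4 < t^2 + 1
      have hxe : (x : ℝ) ^ (1 - ε) = (x : ℝ) / (x : ℝ) ^ ε := by
        rw [Real.rpow_sub hxpos, Real.rpow_one]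
      have hxεpos : (0 : ℝ) < (x : ℝ) ^ ε := Real.rpow_pos_of_pos hxpos ε
      have h1 : (p : ℝ) * (x : ℝ) ^ (1 - ε) ≤ (x : ℝ) * (x : ℝ) / (x : ℝ) ^ ε := by
        rw [hxe, ← mul_div_assoc]
        exact div_le_div_of_nonneg_right (mul_le_mul_of_nonneg_right hpx hxpos.le) hxεpos.le
      have h2 : (x : ℝ) * (x : ℝ) / (x : ℝ) ^ ε ≤ (x : ℝ) * (x : ℝ) * (c ^ 2 / 4) := by
        rw [div_le_iff₀ hxεpos]
        have h4 : (1 : ℝ) ≤ c ^ 2 / 4 * (x : ℝ) ^ ε := by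
          have := (div_le_iff₀ (by positivity : (0 : ℝ) < c ^ 2)).mp hlarge
          linarith [this]
        nlinarith [mul_nonneg hxpos.le hxpos.le]
      have h3 : (x : ℝ) * (x : ℝ) * (c ^ 2 / 4) = (c / 2 * (x : ℝ)) ^ 2 := by ring
      have h4 : (c / 2 * (x : ℝ)) ^ 2 < (t : ℝ) ^ 2 + 1 := by
        have h5 : (c / 2 * (x : ℝ)) ^ 2 < (t : ℝ) ^ 2 := by
          have h0 : (0 : ℝ) ≤ c / 2 * (x : ℝ) := by positivity
          nlinarith [h0, hsmall]
        linarith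
      calc (p : ℝ) * (x : ℝ) ^ (1 - ε) ≤ (x : ℝ) * (x : ℝ) / (x : ℝ) ^ ε := h1
        _ ≤ (x : ℝ) * (x : ℝ) * (c ^ 2 / 4) := h2
        _ = (c / 2 * (x : ℝ)) ^ 2 := h3
        _ < (t : ℝ) ^ 2 + 1 := h4
  have hcard : S.card ≤ A.card + T.card :=
    (Finset.card_le_card hsub).trans (Finset.card_union_le _ _)
  have hcard' : (S.card : ℝ) ≤ (A.card : ℝ) + (T.card : ℝ) := by exact_mod_cast hcard
  linarith

end Summit.Parity.BatemanHorn.Theorems
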